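import Summits.CriticalPhenomena.PercolationContinuityZ3.Theses.PercNearOneGluing
import Summits.CriticalPhenomena.PercolationContinuityZ3.Theorems.PercNearOneGluingNearOneGluingTerminalSeparation
import Summits.CriticalPhenomena.PercolationContinuityZ3.Theorems.PercNearOneGluingNearOneGluingSingleFinger
import Summits.CriticalPhenomena.PercolationContinuityZ3.Theorems.PercNearOneGluingNearOneGluingDyadicThinning
import Summits.CriticalPhenomena.PercolationContinuityZ3.Theorems.PercNearOneGluingNearOneGluingWeightContinuity
import Summits.CriticalPhenomena.PercolationContinuityZ3.Theorems.PercNearOneGluingNoHeavyLowerTailSpreadSwitch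
import Summits.CriticalPhenomena.PercolationContinuityZ3.Theorems.PercNearOneGluingNoHeavyLowerTailOneFingerHub
import Summits.CriticalPhenomena.PercolationContinuityZ3.Theorems.PercNearOneGluingNoHeavyLowerTailFewFingersHub
import Literature.Probability.Percolation.ConditionalPositiveAssociation
import Literature.Probability.Percolation.ConditionalPositiveAssociationProofs
import Literature.Probability.Percolation.PercolationProofs

/-!
# Line `bhk-superadditivity-thinning` — skeleton for the crux `PercNearOneGluing.NoHeavyLowerTail`
(crux item stmt-CriticalPhenomena-4575, rank 4, route `route-CriticalPhenomena-PercNearOneGluing`;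
crux-plan seat `planner-cruxplan-stmt-CriticalPhenomena-4575-bhk-superadditivity--0`, 2026-08-16;
RESHAPED by the line lead `prover-line-stmt-CriticalPhenomena-4575-0`, 2026-08-16, see §Reshape)

Crux (FIXED, by name): `NoHeavyLowerTail` — for every `ε > 0` there is `δ > 0` such that on every
finite weighted graph (`Fin n`, weights `w`, measure `prodBernoulli w`), if `P(o ↔ A) > 1 − δ` (H1)
and `P(a ↔ a') > 1 − δ` for all `a, a' ∈ A` (H2), then `P(1 ≤ N < (δ/ε)·E N) < ε`, where
`N = |C(o) ∩ A|` (typed `(A.filter fun a => ω ∈ openConn o a).card`) and `E N = Σ_{a∈A} P(o ↔ a)`.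
By the disprover's `iff_nearOneGluing` (Disproof.lean §B) the crux is EQUIVALENT to the route
thesis `NearOneGluing` = Kozma–Nitzan Conjecture 3 (arXiv:2401.12397 p.15), an open problem; every
line on it is a line on Conjecture 3.

Idea (card `Ideas/bhk-superadditivity-thinning.md`, triage r1-1/2/3: pass ×3): van den
Berg–Häggström–Kahn conditional positive association (RSA 2006, Thm 1.3) gives Kozma–Nitzan's
superadditivity lemma with SINGLETON blocks, which prices all one-point pockets at once
(`P(|C(o) ∩ T| = 1, o ↮ a₀) ≤ max_{a ∈ T} P(a ↮ a₀)`, uniformly in `|T|`); an independent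
Bernoulli thinning of the relay set turns "`|C(o) ∩ A'| ∈ [m,2m)`" into "exactly one thinned point"
with probability `≥ 1/16`, so every dyadic scale costs `≤ 16δ₀` (`δ₀` = star budget
`max_a P(a ↮ a₀)` to a hub `a₀ ∈ A`): THEOREM D,
`P(o ↮ a₀, 1 ≤ |C(o) ∩ (A∖a₀)| < t) ≤ 16 δ₀ ⌈log₂ t⌉`, with NO hypothesis on `o`. On `{o ↔ a₀}`
the bad event is a large-deviation event for the hub's block and costs `≤ 2δ₀` (Markov). What is
left is the removal of the `log`: LARGE pockets (at least `s₀` points, any fixed `s₀`) cut from the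
hub must cost `o(1)` as `δ → 0`.

## Reshape (lead, 2026-08-16)

* S1 `stub_bhk` is DISCHARGED in the tree: `Literature.Probability.Percolation.
  BHK2006_clusterConditionalPositiveAssociation_holds` (ConditionalPositiveAssociationProofs.lean).
  It is now the proved theorem `bhk` (no stub).
* S2/S3 are PROVED here from the landed Theorems files of the sibling crux stmt-4574 (line
  `bhk-dyadic-thinning`: `stub_terminalSeparation`, `stub_singleFinger`, `stub_weightContinuity`,
  `stub_dyadicThinning`, all accepted under `Theorems/PercNearOneGluingNearOneGluing*.lean`):
  `singleFingerHub` (= KN Lemma 2 with singleton blocks, hub form, denominator-free) and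
  `logScaleLowerTail` (= Theorem D with constant `16` instead of the card's `8`). No stub.
* S5 `stub_largePocketBound` (the residual, linear form `C(δ₀ + √δ₁)`) is SPLIT by the number of
  PIONEERS of `o` (relay points reached by an open path whose interior avoids `A`; card
  `afree-cluster-pioneers`, triage pass ×3), in hub form:
  - `stub_spreadSwitch` — the four-functions "spread switch" (card meet-closure-four-functions Z2;
    identical to the signature registered for line `afree-cluster-pioneers`), size M;
  - `stub_oneFingerHub` — pockets cut from the hub entered through ≤ 1 pioneer cost
    `δ₀ + 2√δ₁` (afree P2 in hub form: the unique pioneer `a` has `a ↮ a₀`; spread switch over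
    `Q_a = {D = {a}} ∩ {a ↮ a₀}`, meets in `{D = ∅} ⊆ {o ↮ A}`), size M;
  - `stub_fewFingersHub` — `2 ≤ |D| ≤ d` pioneers cost `C_d (δ₀ + δ₁)^{κ_d}` (afree P3 in hub form:
    popularity threshold + spread switch, induction on the level, `κ_d = 2^{-d}`), size L;
  - `stub_manyFingersLargePocket` — the RESIDUAL (held by the lead), in ε–δ form: for every ε
    there are δ, d₀, s₀ such that pockets cut from the hub with `≥ s₀` relay points, `≤ |A|/2` of
    them, and MORE than `d₀` pioneers cost `≤ ε` under pairwise `δ`-reliability of `A` and observer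
    budget `δ`. Weaker than S5, than afree's MFB and than the crux itself (no rate); implied by the
    card's Transfer LLT-hub (`manyFingersLargePocket_of_linearLowerTailHub`, proved) hence by
    AdditiveGluing (stmt-4576); EQUIVALENT to the crux given the landed stubs.
* `NoHeavyLowerTail_of` recomposed accordingly (kernel-checked, no `sorry` of its own).

Disproof.lean (cdisprove seat; read through the item's evidence notes — the evidence store is not
mounted in prover jails either) honoured: §B no stub restates the crux / `NearOneGluing` /
`PointFromSet`; §C.1 (H2 load-bearing) — H2 is consumed by `hubBlockMarkov`, `logScaleLowerTail`,
the one/few-finger stubs (budget `P(a ↮ a₀) ≤ δ`) and the residual (pairwise form); §C.2 (H1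
dispensable granted 4576) — H1 enters only through `δ₁` in the finger stubs; §D.3 (any valid
`δ(ε) ≤ ε`) — the composition's `δ ≤ ε/2` and is polynomially small; §E trivial regime — the
residual keeps `s₀ ≤ N'`, `2N' ≤ |A|`.
-/

noncomputable section

namespace Summit.CriticalPhenomena.PercolationContinuityZ3.Cruxes.NoHeavyLowerTail.BhkSuperadditivityThinning

open scoped Classical BigOperators Topology
open MeasureTheory Set Filter
open Literature.Probability.LatticeModels (prodBernoulli)
open Literature.Probability.Percolation (openConn openConnIn BondConfig
  BHK2006_clusterConditionalPositiveAssociation BHK2006_clusterConditionalPositiveAssociation_holds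
  measurableSet_openConn_holds)
open Summit.CriticalPhenomena.PercolationContinuityZ3.Theses.PercNearOneGluing (NoHeavyLowerTail)
open Summit.CriticalPhenomena.PercolationContinuityZ3.Theorems (stub_terminalSeparation
  stub_singleFinger stub_dyadicThinning stub_weightContinuity)

/-! ## S1 — van den Berg–Häggström–Kahn 2006, Theorem 1.3 (DISCHARGED in the tree) -/

/-- **S1 (proved).** BHK 2006 Thm 1.3 at universe `0`: the Literature fact is discharged by
`BHK2006_clusterConditionalPositiveAssociation_holds`. -/
theorem bhk : BHK2006_clusterConditionalPositiveAssociation.{0} :=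
  BHK2006_clusterConditionalPositiveAssociation_holds

/-! ## S2 — single finger, hub form (PROVED from the sibling crux's landed theorems) -/

/-- **S2 (proved) — single-finger lemma, hub form** (Kozma–Nitzan arXiv:2401.12397 Lemma 2 with
singleton blocks on the ground set `T ∪ {a₀}`): if every `a ∈ T` has `P(a ↮ a₀) ≤ t` then
`P(exactly one point of T is joined to o, and o ↮ a₀) ≤ t`, with NO factor `|T|`.
Chain: BHK Thm 1.3 (`_holds`, at `Fin n`) ⇒ terminal separation ⇒ single finger (weight
continuity disposes of null separation events), all landed for crux stmt-4574. -/
theorem singleFingerHub :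
    ∀ (n : ℕ) (w : Sym2 (Fin n) → unitInterval) (T : Finset (Fin n)) (o a₀ : Fin n) (t : ℝ),
      0 ≤ t → (∀ a ∈ T, (prodBernoulli w).real (openConn a a₀)ᶜ ≤ t) →
      (prodBernoulli w).real {ω : BondConfig (Fin n) |
          (T.filter fun a => ω ∈ openConn o a).card = 1 ∧ ω ∉ openConn o a₀} ≤ t := by
  refine stub_singleFinger (stub_terminalSeparation ?_) stub_weightContinuity
  intro n w s X F G hF hG hs
  exact bhk (Fin n) w s X F G hF hG hs

/-! ## S3 — THEOREM D: log-scale lower tail (PROVED; constant 16) -/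

/-- **S3 (proved) — Theorem D of the card, constant `16`.** For every finite weighted graph, relay
set `A`, hub `a₀ ∈ A` with star budget `P(a ↮ a₀) ≤ δ₀ (a ∈ A)`, observer `o` (NO hypothesis on
`o`) and `t`: `P(o ↮ a₀, 1 ≤ N' < t) ≤ 16 δ₀ ⌈log₂ t⌉`, `N' = |C(o) ∩ (A∖a₀)|`.
Proof: dyadic thinning (sibling theorem `stub_dyadicThinning`, `16·L·t` for the window
`[K, K·2^L)`) fed with `singleFingerHub`, at `K = 1`, `L = ⌈log₂ t⌉`, relay set `A.erase a₀`,
target `b := a₀`; `t ≤ 2^{⌈log₂ t⌉}` (`Nat.le_pow_clog`). -/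
theorem logScaleLowerTail
    (n : ℕ) (w : Sym2 (Fin n) → unitInterval) (A : Finset (Fin n)) (o a₀ : Fin n) (δ₀ : ℝ) (t : ℕ)
    (ha₀ : a₀ ∈ A) (hδ₀ : ∀ a ∈ A, (prodBernoulli w).real (openConn a a₀)ᶜ ≤ δ₀) :
    (prodBernoulli w).real {ω : BondConfig (Fin n) | ω ∉ openConn o a₀ ∧
        1 ≤ ((A.erase a₀).filter fun a => ω ∈ openConn o a).card ∧
        ((A.erase a₀).filter fun a => ω ∈ openConn o a).card < t}
      ≤ 16 * δ₀ * (Nat.clog 2 t : ℝ) := by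
  have hδ₀0 : 0 ≤ δ₀ := le_trans measureReal_nonneg (hδ₀ a₀ ha₀)
  have h := stub_dyadicThinning singleFingerHub n w (A.erase a₀) o a₀ δ₀ 1 (Nat.clog 2 t) hδ₀0
    le_rfl (fun a ha => hδ₀ a (Finset.mem_of_mem_erase ha))
  have hpow : t ≤ 1 * 2 ^ Nat.clog 2 t := by
    rw [one_mul]; exact Nat.le_pow_clog one_lt_two t
  calc (prodBernoulli w).real {ω : BondConfig (Fin n) | ω ∉ openConn o a₀ ∧
        1 ≤ ((A.erase a₀).filter fun a => ω ∈ openConn o a).card ∧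
        ((A.erase a₀).filter fun a => ω ∈ openConn o a).card < t}
      ≤ (prodBernoulli w).real {ω : BondConfig (Fin n) | ω ∉ openConn o a₀ ∧
        1 ≤ ((A.erase a₀).filter fun a => ω ∈ openConn o a).card ∧
        ((A.erase a₀).filter fun a => ω ∈ openConn o a).card < 1 * 2 ^ Nat.clog 2 t} := by
          refine measureReal_mono ?_
          rintro ω ⟨h1, h2, h3⟩
          exact ⟨h1, h2, lt_of_lt_of_le h3 hpow⟩
    _ ≤ 16 * (Nat.clog 2 t : ℝ) * δ₀ := h
    _ = 16 * δ₀ * (Nat.clog 2 t : ℝ) := by ring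

/-! ## The hub block: first-moment (Markov) bound — PROVED -/

/-- **Hub block bound (proved).** On `{o ↔ a₀}` the relay points joined to `o` are exactly those
joined to the hub `a₀`, so `N = |A| − Y` with `Y = #{a ∈ A : a ↮ a₀}`; Markov's inequality for
`Y` (a sum of indicators, `E Y = Σ_a P(a ↮ a₀)`) gives
`P(o ↔ a₀, N < t) ≤ P(Y ≥ |A| − t) ≤ (Σ_{a∈A} P(a ↮ a₀)) / (|A| − t)` for `t < |A|`. -/
theorem hubBlockMarkov
    (n : ℕ) (w : Sym2 (Fin n) → unitInterval) (A : Finset (Fin n)) (o a₀ : Fin n) (t : ℝ)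
    (ht : t < A.card) :
    (prodBernoulli w).real {ω : BondConfig (Fin n) | ω ∈ openConn o a₀ ∧
        ((A.filter fun a => ω ∈ openConn o a).card : ℝ) < t}
      ≤ (∑ a ∈ A, (prodBernoulli w).real (openConn a a₀)ᶜ) / (A.card - t) := by
  set μ := prodBernoulli w with hμ
  -- the deficit `Y` = number of relay points cut from the hub, as a sum of indicators
  set Y : BondConfig (Fin n) → ℝ :=
    fun ω => ∑ a ∈ A, ((openConn a a₀ : Set (BondConfig (Fin n)))ᶜ).indicator (fun _ => (1 : ℝ)) ω
    with hY
  have hmeas : ∀ a ∈ A, MeasurableSet ((openConn a a₀ : Set (BondConfig (Fin n)))ᶜ) :=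
    fun a _ => (measurableSet_openConn_holds a a₀).compl
  have hint : ∀ a ∈ A, Integrable
      (((openConn a a₀ : Set (BondConfig (Fin n)))ᶜ).indicator (fun _ => (1 : ℝ))) μ :=
    fun a ha => (integrable_const (1 : ℝ)).indicator (hmeas a ha)
  have hY_int : Integrable Y μ := integrable_finsetSum A hint
  have hY_nonneg : 0 ≤ᵐ[μ] Y := Filter.Eventually.of_forall fun ω =>
    Finset.sum_nonneg fun a _ => Set.indicator_nonneg (fun _ _ => zero_le_one) _
  have hY_integral : ∫ ω, Y ω ∂μ = ∑ a ∈ A, μ.real (openConn a a₀)ᶜ := by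
    rw [integral_finsetSum A hint]
    refine Finset.sum_congr rfl fun a ha => ?_
    rw [integral_indicator_const (1 : ℝ) (hmeas a ha), smul_eq_mul, mul_one]
  -- on the event, `Y = |A| - N > |A| - t`
  have hsub : {ω : BondConfig (Fin n) | ω ∈ openConn o a₀ ∧
      ((A.filter fun a => ω ∈ openConn o a).card : ℝ) < t} ⊆ {ω | (A.card : ℝ) - t ≤ Y ω} := by
    rintro ω ⟨hoa, hN⟩
    have hfilt : (A.filter fun a => ω ∈ openConn o a) = (A.filter fun a => ω ∈ openConn a a₀) := by
      refine Finset.filter_congr fun a _ => ?_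
      simp only [openConn, Set.mem_setOf_eq] at hoa ⊢
      exact ⟨fun h => h.symm.trans hoa, fun h => hoa.trans h.symm⟩
    have hYω : Y ω = (A.card : ℝ) - ((A.filter fun a => ω ∈ openConn a a₀).card : ℝ) := by
      have hterm : ∀ a ∈ A,
          ((openConn a a₀ : Set (BondConfig (Fin n)))ᶜ).indicator (fun _ => (1 : ℝ)) ω
            = 1 - (if ω ∈ openConn a a₀ then (1 : ℝ) else 0) := by
        intro a _
        by_cases h : ω ∈ openConn a a₀ <;> simp [h]
      simp only [hY]
      rw [Finset.sum_congr rfl hterm, Finset.sum_sub_distrib, Finset.sum_const, nsmul_eq_mul,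
        mul_one, Finset.sum_boole]
    show (A.card : ℝ) - t ≤ Y ω
    rw [hYω]
    rw [hfilt] at hN
    linarith
  have hpos : 0 < (A.card : ℝ) - t := by linarith
  have hmarkov := mul_meas_ge_le_integral_of_nonneg hY_nonneg hY_int ((A.card : ℝ) - t)
  rw [hY_integral] at hmarkov
  calc μ.real {ω : BondConfig (Fin n) | ω ∈ openConn o a₀ ∧
        ((A.filter fun a => ω ∈ openConn o a).card : ℝ) < t}
      ≤ μ.real {ω | (A.card : ℝ) - t ≤ Y ω} := measureReal_mono hsub
    _ ≤ (∑ a ∈ A, μ.real (openConn a a₀)ᶜ) / (A.card - t) := by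
        rw [le_div_iff₀ hpos]
        linarith [hmarkov]

/-! ## S4a — the spread switch (engine of the finger count; LANDED p72996) -/

/-- **S4a `stub_spreadSwitch`** (the engine; size M; card `meet-closure-four-functions` Z2 in zone
form, constant `2` as sharpened by triage r1-1/r1-2; signature identical to the one registered for
line `afree-cluster-pioneers`).  Let `Q₀, …, Q_{L-1}` be pairwise disjoint events of bond
configurations on `Fin n` such that the MEET `ω ∩ ω'` (intersection of the open-edge sets) of any
two configurations taken from two different `Q_i` lies in the zone `Z`.  Then under any product
measure `prodBernoulli w`: `∑_i P(Q_i) ≤ m + 2 √P(Z)` whenever every `P(Q_i) ≤ m` (`0 ≤ m`).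
Proof: for an index split `I ⊔ Iᶜ`, Ahlswede–Daykin (Mathlib `Finset.four_functions_theorem` on
the distributive lattice `Set (Sym2 (Fin n))` / `Finset`, with `f₁ = 1_{⋃_I Q}·μ`,
`f₂ = 1_{⋃_{Iᶜ} Q}·μ`, `f₃ = 1_Z·μ`, `f₄ = μ`, where `μ{ω}μ{ω'} = μ{ω ∩ ω'}μ{ω ∪ ω'}` for the
product point masses, `Literature.Probability.Percolation.BHK2006.weight_inter_mul_union`) gives
`P(⋃_I Q)·P(⋃_{Iᶜ} Q) ≤ P(Z)·1`; a greedy split makes both factors `≥ (∑ - max)/2` unless one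
class dominates, whence `∑ ≤ max + 2√P(Z)`. Why true: a theorem (exact checks: triage r1-3
local_checks.py Z2, cruxplan skeleton_check.py, 0 violations). -/
theorem stub_spreadSwitch :
    ∀ (n L : ℕ) (w : Sym2 (Fin n) → unitInterval) (Q : Fin L → Set (BondConfig (Fin n)))
      (Z : Set (BondConfig (Fin n))) (m : ℝ),
      0 ≤ m →
      (∀ i j, i ≠ j → Disjoint (Q i) (Q j)) →
      (∀ i j, i ≠ j → ∀ ω ∈ Q i, ∀ ω' ∈ Q j, ω ∩ ω' ∈ Z) →
      (∀ i, (prodBernoulli w).real (Q i) ≤ m) →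
      ∑ i, (prodBernoulli w).real (Q i) ≤ m + 2 * Real.sqrt ((prodBernoulli w).real Z) :=
  Summit.CriticalPhenomena.PercolationContinuityZ3.Theorems.stub_spreadSwitch

/-! ## S4b — one finger is harmless, hub form (LANDED p73388) -/

/-- **S4b `stub_oneFingerHub`** (size M; card afree P2 in hub form).  Assuming the spread switch:
for a hub `a₀ ∈ A`, an observer `o ∉ A`, star budget `P(a ↮ a₀) ≤ δ₀ (a ∈ A)` and observer budget
`P(o ↮ A) ≤ δ₁`, the event "`o ↮ a₀`, `o` is joined to some point of `A ∖ a₀`, and `o` has AT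
MOST ONE pioneer" has probability `≤ δ₀ + 2√δ₁`.  Here the PIONEERS of `ω` are
`D(ω) = {a ∈ A | ω ∈ openConnIn (Aᶜ ∪ {o, a}) o a}` (relay points reached from `o` by an open path
whose interior avoids `A`).  Percolation content: (i) on the event there is an open path from `o`
to `A`, whose first vertex in `A` is a pioneer, so `D = {a}` for a unique `a`; (ii) `a ∈ C(o)` and
`o ↮ a₀` give `a ↮ a₀`, so the part with pioneer `a` lies in `Q_a := {D = {a}} ∩ {a ↮ a₀}`,
`P(Q_a) ≤ δ₀`; (iii) the `Q_a` are pairwise disjoint, `D` is monotone (each `{a ∈ D}` is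
increasing), so the meet of `ω ∈ Q_a`, `ω' ∈ Q_b` (`a ≠ b`) has `D = ∅`, i.e. lies in
`Z := {D = ∅} ⊆ {o ↮ A}` (an open `o → A` path yields a pioneer); the spread switch (index the
relay points by `Fin |A|`) gives `∑_a P(Q_a) ≤ δ₀ + 2√P(o ↮ A) ≤ δ₀ + 2√δ₁`.
Hypotheses force `0 ≤ δ₀` (`a = a₀`) and `0 ≤ δ₁`. -/
theorem stub_oneFingerHub :
    (∀ (n L : ℕ) (w : Sym2 (Fin n) → unitInterval) (Q : Fin L → Set (BondConfig (Fin n)))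
      (Z : Set (BondConfig (Fin n))) (m : ℝ),
      0 ≤ m →
      (∀ i j, i ≠ j → Disjoint (Q i) (Q j)) →
      (∀ i j, i ≠ j → ∀ ω ∈ Q i, ∀ ω' ∈ Q j, ω ∩ ω' ∈ Z) →
      (∀ i, (prodBernoulli w).real (Q i) ≤ m) →
      ∑ i, (prodBernoulli w).real (Q i) ≤ m + 2 * Real.sqrt ((prodBernoulli w).real Z)) →
    ∀ (n : ℕ) (w : Sym2 (Fin n) → unitInterval) (A : Finset (Fin n)) (o a₀ : Fin n) (δ₀ δ₁ : ℝ),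
      a₀ ∈ A → o ∉ A →
      (∀ a ∈ A, (prodBernoulli w).real (openConn a a₀)ᶜ ≤ δ₀) →
      (prodBernoulli w).real (⋃ a ∈ A, openConn o a)ᶜ ≤ δ₁ →
      (prodBernoulli w).real {ω : BondConfig (Fin n) | ω ∉ openConn o a₀ ∧
          1 ≤ ((A.erase a₀).filter fun a => ω ∈ openConn o a).card ∧
          (A.filter fun a => ω ∈ openConnIn ((↑A : Set (Fin n))ᶜ ∪ {o, a}) o a).card ≤ 1}
        ≤ δ₀ + 2 * Real.sqrt δ₁ :=
  Summit.CriticalPhenomena.PercolationContinuityZ3.Theorems.stub_oneFingerHub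

/-! ## S4d — few fingers are harmless, hub form (LANDED p74084) -/

/-- **S4d `stub_fewFingersHub`** (size L; card afree P3 in hub form).  Assuming the spread switch:
for every `d` there are `C, κ > 0` such that for a hub `a₀ ∈ A`, an observer `o ∉ A`, star budget
`δ₀` and observer budget `δ₁`, the event "`o ↮ a₀` and `o` has between `2` and `d` pioneers" has
probability `≤ C (δ₀ + δ₁)^κ` (pioneers as in S4b).
Proof for `d = 2` (`κ = 1/4`): call `a ∈ A` POPULAR if `P(a ∈ D, |D| ≤ 2) ≥ η`; since
`Σ_a P(a ∈ D, |D| ≤ 2) = E[|D|; |D| ≤ 2] ≤ 2` there are at most `2/η` popular points, and a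
popular pioneer `a` on the event has `a ∈ C(o)`, `o ↮ a₀`, hence `a ↮ a₀`: total `≤ (2/η) δ₀`.
The parts `Q_{ab} = {D = {a, b}}` over pairs of UNPOPULAR points are pairwise disjoint, each of
mass `≤ η`, and (monotonicity of `D`) the meet of two of them has `|D| ≤ 1` with `D` unpopular, i.e.
lies in `Z = {D = ∅} ∪ ⋃_{x unpopular} {D = {x}}`, of mass `≤ δ₁ + (η + 2√δ₁)` (spread switch on the
singletons); so the spread switch bounds their total by `η + 2√(δ₁ + η + 2√δ₁)`; take
`η := √(δ₀ + δ₁)` (if `δ₀ + δ₁ = 0` the event is null: every `a ∈ A` is a.s. joined to `a₀`, and a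
pioneer lies in `C(o) ∌ a₀`).  General `d`: induction on the level `k ≤ d` with ONE popularity
threshold `η` (popular iff `P(a ∈ D, |D| ≤ d) ≥ η`, at most `d/η` points): level-`k` parts over
all-unpopular `k`-sets are disjoint with meets in the union of the lower all-unpopular levels and
`{D = ∅}`, each level adding one square root, `κ_d = 2^{-d}` (FindingsIdeator3 R6). -/
theorem stub_fewFingersHub :
    (∀ (n L : ℕ) (w : Sym2 (Fin n) → unitInterval) (Q : Fin L → Set (BondConfig (Fin n)))
      (Z : Set (BondConfig (Fin n))) (m : ℝ),
      0 ≤ m →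
      (∀ i j, i ≠ j → Disjoint (Q i) (Q j)) →
      (∀ i j, i ≠ j → ∀ ω ∈ Q i, ∀ ω' ∈ Q j, ω ∩ ω' ∈ Z) →
      (∀ i, (prodBernoulli w).real (Q i) ≤ m) →
      ∑ i, (prodBernoulli w).real (Q i) ≤ m + 2 * Real.sqrt ((prodBernoulli w).real Z)) →
    ∀ d : ℕ, ∃ C κ : ℝ, 0 < C ∧ 0 < κ ∧
      ∀ (n : ℕ) (w : Sym2 (Fin n) → unitInterval) (A : Finset (Fin n)) (o a₀ : Fin n) (δ₀ δ₁ : ℝ),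
        a₀ ∈ A → o ∉ A →
        (∀ a ∈ A, (prodBernoulli w).real (openConn a a₀)ᶜ ≤ δ₀) →
        (prodBernoulli w).real (⋃ a ∈ A, openConn o a)ᶜ ≤ δ₁ →
        (prodBernoulli w).real {ω : BondConfig (Fin n) | ω ∉ openConn o a₀ ∧
            2 ≤ (A.filter fun a => ω ∈ openConnIn ((↑A : Set (Fin n))ᶜ ∪ {o, a}) o a).card ∧
            (A.filter fun a => ω ∈ openConnIn ((↑A : Set (Fin n))ᶜ ∪ {o, a}) o a).card ≤ d}
          ≤ C * (δ₀ + δ₁) ^ κ :=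
  Summit.CriticalPhenomena.PercolationContinuityZ3.Theorems.stub_fewFingersHub

/-! ## S4c (HARDEST, held by the lead) — many-finger large pockets -/

/-- **S4c `stub_manyFingersLargePocket` — the residual of the line (ε–δ form).**  For every
`ε > 0` there are `δ > 0` and sizes `d₀, s₀` such that on every finite weighted graph, for a relay
set `A` that is pairwise `δ`-reliable (`P(a ↮ a') ≤ δ`, `a, a' ∈ A`), a hub `a₀ ∈ A`, and an
observer `o ∉ A` with `P(o ↮ A) ≤ δ`:
  `P(o ↮ a₀, s₀ ≤ N', 2N' ≤ |A|, |D| > d₀) ≤ ε`,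
`N' = |C(o) ∩ (A∖a₀)|`, `D` = the pioneers of S4b — LARGE pockets (at least `s₀` relay points, at
most half of `A`), cut from the hub, entered through MANY pioneers, cost `o(1)`; the sizes `d₀, s₀`
may depend on `ε` (the composition fixes its own `δ' ≤ δ` AFTER them, so Theorem D and the
finger stubs absorb everything below `s₀` points / `d₀` pioneers).  RESHAPED by the lead
(2026-08-16) from the planner's linear form `C(δ₀ + √δ₁)` and the lead's first polynomial-rate
form `C(δ₀+δ₁)^κ`: both are rate STRENGTHENINGS of the crux; this form is implied by the crux
itself (the event lies in `{o ↔ A} ∩ {o ↮ a₀}`, and the crux ≡ KN Conjecture 3 by Disproof §B), so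
the stub cannot be false unless the crux is, and it is still closed by the card's Transfer LLT-hub
(`manyFingersLargePocket_of_linearLowerTailHub`, proved) hence by `AdditiveGluing` (stmt-4576).
Why plausibly true: (i) every exact sweep (lead's cex campaign 2026-08-16: 5 276 weight-optimised
instances in 9 families incl. multi-scale pockets, antechambers, PG(2,2), planar boxes, GW-trees:
sup of the LINEAR hub ratio = 1 exactly, no growth in |A|) is consistent even with the linear form;
(ii) the structure available only here (afree P4): given the `A`-free cluster `C*` of `o`, the
`> d₀` pioneers are INDEPENDENT Bernoulli entrances that must ALL lead into one set sealed from the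
hub in the relay world `G − C*`, and the pocket is large and sparse; (iii) Kozma–Nitzan Thm 4 +
Lemma 5 in the `C*`-contracted world (sibling theorems `depthOneGluing`, `pocketBound`) bound the
bad mass of each pocket shape `W` by `min_{a admissible} P(o ↔ A, a ↮ a₀ | C* = W)`.  Why it might
fail: it is KN Conjecture 3 restricted to the configurations the BHK lever and the finger count
cannot reach (uniformity in `|A|` across ≳ 1/δ footprint scales).  Size: open. -/
theorem stub_manyFingersLargePocket :
    ∀ ε : ℝ, 0 < ε → ∃ (δ : ℝ) (d₀ s₀ : ℕ), 0 < δ ∧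
      ∀ (n : ℕ) (w : Sym2 (Fin n) → unitInterval) (A : Finset (Fin n)) (o a₀ : Fin n),
        a₀ ∈ A → o ∉ A →
        (∀ a ∈ A, ∀ a' ∈ A, (prodBernoulli w).real (openConn a a')ᶜ ≤ δ) →
        (prodBernoulli w).real (⋃ a ∈ A, openConn o a)ᶜ ≤ δ →
        (prodBernoulli w).real {ω : BondConfig (Fin n) | ω ∉ openConn o a₀ ∧
            s₀ ≤ ((A.erase a₀).filter fun a => ω ∈ openConn o a).card ∧
            2 * ((A.erase a₀).filter fun a => ω ∈ openConn o a).card ≤ A.card ∧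
            d₀ < (A.filter fun a => ω ∈ openConnIn ((↑A : Set (Fin n))ᶜ ∪ {o, a}) o a).card}
          ≤ ε := by
  sorry

/-! ## The card's Transfer C⁺ (LLT, hub form) closes S4c — documentation, proved -/

/-- **Transfer `C⁺` of the card (LLT — linear lower tail — in HUB form)**, written as the
hypothesis `h`: `∃ C`, for every instance and hub, `P(o ↮ a₀, 1 ≤ N', 2N' ≤ |A|) ≤ C · δ₀`
whenever `P(a ↮ a₀) ≤ δ₀` for all `a ∈ A`.  No hypothesis on `o`, one parameter, refutable by a
family; `AdditiveGluing` (stmt-4576, `b := a₀`) gives it with `C = 1`.  This lemma records that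
the Transfer closes the residual S4c (`δ = ε / max C 1`, `d₀ = 0`, `s₀ = 1`), so refuters' LLT
sweeps bear on a typed statement. -/
theorem manyFingersLargePocket_of_linearLowerTailHub
    (h : ∃ C : ℝ, ∀ (n : ℕ) (w : Sym2 (Fin n) → unitInterval) (A : Finset (Fin n)) (o a₀ : Fin n)
      (δ₀ : ℝ), a₀ ∈ A → (∀ a ∈ A, (prodBernoulli w).real (openConn a a₀)ᶜ ≤ δ₀) →
      (prodBernoulli w).real {ω : BondConfig (Fin n) | ω ∉ openConn o a₀ ∧
          1 ≤ ((A.erase a₀).filter fun a => ω ∈ openConn o a).card ∧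
          2 * ((A.erase a₀).filter fun a => ω ∈ openConn o a).card ≤ A.card} ≤ C * δ₀) :
    ∀ ε : ℝ, 0 < ε → ∃ (δ : ℝ) (d₀ s₀ : ℕ), 0 < δ ∧
      ∀ (n : ℕ) (w : Sym2 (Fin n) → unitInterval) (A : Finset (Fin n)) (o a₀ : Fin n),
        a₀ ∈ A → o ∉ A →
        (∀ a ∈ A, ∀ a' ∈ A, (prodBernoulli w).real (openConn a a')ᶜ ≤ δ) →
        (prodBernoulli w).real (⋃ a ∈ A, openConn o a)ᶜ ≤ δ →
        (prodBernoulli w).real {ω : BondConfig (Fin n) | ω ∉ openConn o a₀ ∧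
            s₀ ≤ ((A.erase a₀).filter fun a => ω ∈ openConn o a).card ∧
            2 * ((A.erase a₀).filter fun a => ω ∈ openConn o a).card ≤ A.card ∧
            d₀ < (A.filter fun a => ω ∈ openConnIn ((↑A : Set (Fin n))ᶜ ∪ {o, a}) o a).card}
          ≤ ε := by
  obtain ⟨C, hC⟩ := h
  intro ε hε
  have hC1 : 0 < max C 1 := lt_of_lt_of_le one_pos (le_max_right _ _)
  refine ⟨ε / max C 1, 0, 1, div_pos hε hC1, fun n w A o a₀ ha₀ _ hδ₀ _ => ?_⟩
  have hδ0 : 0 ≤ ε / max C 1 := (div_pos hε hC1).le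
  calc (prodBernoulli w).real {ω : BondConfig (Fin n) | ω ∉ openConn o a₀ ∧
            1 ≤ ((A.erase a₀).filter fun a => ω ∈ openConn o a).card ∧
            2 * ((A.erase a₀).filter fun a => ω ∈ openConn o a).card ≤ A.card ∧
            0 < (A.filter fun a => ω ∈ openConnIn ((↑A : Set (Fin n))ᶜ ∪ {o, a}) o a).card}
        ≤ (prodBernoulli w).real {ω : BondConfig (Fin n) | ω ∉ openConn o a₀ ∧
            1 ≤ ((A.erase a₀).filter fun a => ω ∈ openConn o a).card ∧
            2 * ((A.erase a₀).filter fun a => ω ∈ openConn o a).card ≤ A.card} :=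
          measureReal_mono fun ω hω => ⟨hω.1, hω.2.1, hω.2.2.1⟩
    _ ≤ C * (ε / max C 1) := hC n w A o a₀ (ε / max C 1) ha₀ (fun a ha => hδ₀ a ha a₀ ha₀)
    _ ≤ max C 1 * (ε / max C 1) := mul_le_mul_of_nonneg_right (le_max_left _ _) hδ0
    _ = ε := by field_simp

/-! ## Composition — the crux BY NAME from S2, S3, `hubBlockMarkov`, S4a, S4b, S4d, S4c -/

/-- Choice of `δ`: the error budget `(3 + 16L)δ + 2√δ + C₁(2δ)^κ₁` is continuous at `0` with value
`0`, so it is `< ε` for some `0 < δ ≤ min (ε'/2) δ₁` (any positive caps `ε'`, `δ₁`). -/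
theorem exists_delta (ε ε' δ₁ L C₁ κ₁ : ℝ) (hε : 0 < ε) (hε' : 0 < ε') (hδ₁ : 0 < δ₁)
    (hκ₁ : 0 < κ₁) :
    ∃ δ : ℝ, 0 < δ ∧ δ ≤ ε' / 2 ∧ δ ≤ δ₁ ∧
      (3 + 16 * L) * δ + 2 * Real.sqrt δ + C₁ * (2 * δ) ^ κ₁ < ε := by
  set f : ℝ → ℝ := fun x => (3 + 16 * L) * x + 2 * Real.sqrt x + C₁ * (2 * x) ^ κ₁ with hf
  have h2 : Continuous fun x : ℝ => 2 * x := continuous_const.mul continuous_id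
  have hcont : Continuous f := by
    refine (((continuous_const.mul continuous_id).add
      (continuous_const.mul Real.continuous_sqrt)).add
      (continuous_const.mul ((Real.continuous_rpow_const hκ₁.le).comp h2)))
  have hf0 : f 0 < ε := by
    simp [hf, Real.zero_rpow hκ₁.ne', hε]
  have hev : ∀ᶠ x in 𝓝 (0 : ℝ), f x < ε :=
    hcont.continuousAt.eventually_lt continuousAt_const hf0
  have hev' : ∀ᶠ x in 𝓝 (0 : ℝ), x < min (ε' / 2) δ₁ := eventually_lt_nhds (by positivity)
  have hw : ∀ᶠ x in 𝓝[>] (0 : ℝ), (f x < ε ∧ x < min (ε' / 2) δ₁) ∧ 0 < x :=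
    ((hev.and hev').filter_mono nhdsWithin_le_nhds).and self_mem_nhdsWithin
  obtain ⟨δ, ⟨h1, h3⟩, h4⟩ := hw.exists
  exact ⟨δ, h4, (h3.le.trans (min_le_left _ _)), (h3.le.trans (min_le_right _ _)), h1⟩

/-- **`NoHeavyLowerTail_of`** — the kernel-checked composition of the line (no `sorry` of its own;
its only non-standard axiom is the residual stub S4c).  Given `ε`: take `δᵣ, d₀, s₀` from S4c at
`ε/2`, `C₁, κ₁` from S4d at `d₀`, `s₁ = max s₀ 2`, `L = ⌈log₂ s₁⌉`, and `δ ≤ min (ε/2) δᵣ` from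
`exists_delta` with budget `ε/2`.  For an instance satisfying H1, H2 at level `δ`: `A = ∅` makes
the bad event empty; if `o ∈ A` take the hub `a₀ := o`, so the bad event lies in the hub block
(`hubBlockMarkov`, `≤ 2δ`); otherwise fix any hub `a₀ ∈ A`; `t = δ·EN/ε ≤ |A|/2`; the bad event
`{1 ≤ N < t}` lies in `{o ↔ a₀, N < |A|/2}` ∪ `{o ↮ a₀, 1 ≤ N' < s₁}` (Theorem D, `≤ 16δL`) ∪
`{o ↮ a₀, 1 ≤ N', |D| ≤ 1}` (S4b, `≤ δ + 2√δ`) ∪ `{o ↮ a₀, 2 ≤ |D| ≤ d₀}` (S4d, `≤ C₁(2δ)^κ₁`) ∪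
`{o ↮ a₀, s₀ ≤ N', 2N' ≤ |A|, d₀ < |D|}` (S4c at level `δ ≤ δᵣ`, `≤ ε/2`), total `< ε`. -/
theorem NoHeavyLowerTail_of : NoHeavyLowerTail := by
  intro ε hε
  -- the stubs of the line
  obtain ⟨δᵣ, d₀, s₀, hδᵣ, hMany⟩ := stub_manyFingersLargePocket (ε / 2) (by positivity)
  obtain ⟨C₁, κ₁, hC₁, hκ₁, hFew⟩ := stub_fewFingersHub stub_spreadSwitch d₀
  have hOne := stub_oneFingerHub stub_spreadSwitch
  -- constants of the line
  obtain ⟨s₁, hs₁2, hs₀s₁⟩ : ∃ s₁ : ℕ, 2 ≤ s₁ ∧ s₀ ≤ s₁ := ⟨max s₀ 2, le_max_right _ _, le_max_left _ _⟩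
  set L : ℝ := (Nat.clog 2 s₁ : ℝ) with hL_def
  have hL0 : 0 ≤ L := Nat.cast_nonneg _
  obtain ⟨δ, hδ0, hδ1, hδr, hsum⟩ :=
    exists_delta (ε / 2) ε δᵣ L C₁ κ₁ (by positivity) hε hδᵣ hκ₁
  refine ⟨δ, hδ0, fun n w A o hH1 hH2 => ?_⟩
  -- positivity of the error terms
  have hsq0 : 0 ≤ Real.sqrt δ := Real.sqrt_nonneg δ
  have hp1 : 0 ≤ C₁ * (2 * δ) ^ κ₁ := mul_nonneg hC₁.le (Real.rpow_nonneg (by linarith) _)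
  have hLδ : 0 ≤ 16 * δ * L := by positivity
  -- empty relay set: the bad event is empty
  rcases A.eq_empty_or_nonempty with hA | hAne
  · subst hA
    simp [hε]
  have hcard_pos : (0 : ℝ) < A.card := by exact_mod_cast Finset.card_pos.mpr hAne
  -- pairwise budget (H2, load-bearing: Disproof §C.1) and observer budget (H1) are both ≤ δ
  have hpair : ∀ a ∈ A, ∀ a' ∈ A, (prodBernoulli w).real (openConn a a')ᶜ ≤ δ := by
    intro a ha a' ha'
    have h := hH2 a ha a' ha'
    rw [probReal_compl_eq_one_sub (measurableSet_openConn_holds a a')]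
    linarith
  have hδ₁ : (prodBernoulli w).real (⋃ a ∈ A, openConn o a)ᶜ ≤ δ := by
    rw [probReal_compl_eq_one_sub
      (Finset.measurableSet_biUnion A fun a _ => measurableSet_openConn_holds o a)]
    linarith
  -- the threshold t = δ·EN/ε is at most |A|/2
  set EN : ℝ := ∑ a ∈ A, (prodBernoulli w).real (openConn o a) with hEN_def
  have hEN0 : 0 ≤ EN := Finset.sum_nonneg fun a _ => measureReal_nonneg
  have hEN1 : EN ≤ A.card := by
    calc EN ≤ ∑ a ∈ A, (1 : ℝ) := Finset.sum_le_sum fun a _ => measureReal_le_one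
      _ = A.card := by simp
  have ht : δ * EN / ε ≤ (A.card : ℝ) / 2 := by
    have h1 : δ * EN ≤ ε / 2 * A.card := mul_le_mul hδ1 hEN1 hEN0 (by positivity)
    calc δ * EN / ε ≤ ε / 2 * A.card / ε := div_le_div_of_nonneg_right h1 hε.le
      _ = (A.card : ℝ) / 2 := by field_simp
  -- the hub block bound, for any hub
  have hHub : ∀ a₀ ∈ A, (prodBernoulli w).real {ω : BondConfig (Fin n) | ω ∈ openConn o a₀ ∧
      ((A.filter fun a => ω ∈ openConn o a).card : ℝ) < (A.card : ℝ) / 2} ≤ 2 * δ := by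
    intro a₀ ha₀
    have h := hubBlockMarkov n w A o a₀ ((A.card : ℝ) / 2) (by linarith)
    have hsum : (∑ a ∈ A, (prodBernoulli w).real (openConn a a₀)ᶜ) ≤ A.card * δ := by
      calc (∑ a ∈ A, (prodBernoulli w).real (openConn a a₀)ᶜ) ≤ ∑ a ∈ A, δ :=
            Finset.sum_le_sum fun a ha => hpair a ha a₀ ha₀
        _ = A.card * δ := by simp
    calc (prodBernoulli w).real {ω : BondConfig (Fin n) | ω ∈ openConn o a₀ ∧
          ((A.filter fun a => ω ∈ openConn o a).card : ℝ) < (A.card : ℝ) / 2}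
        ≤ (∑ a ∈ A, (prodBernoulli w).real (openConn a a₀)ᶜ) / (A.card - A.card / 2) := h
      _ ≤ (A.card * δ) / (A.card - A.card / 2) := div_le_div_of_nonneg_right hsum (by linarith)
      _ = 2 * δ := by field_simp; ring
  by_cases ho : o ∈ A
  · -- `o` is itself a relay point: take the hub `a₀ := o`; the bad event is in the hub block
    have hsub : {ω : BondConfig (Fin n) | 1 ≤ (A.filter fun a => ω ∈ openConn o a).card ∧
        ((A.filter fun a => ω ∈ openConn o a).card : ℝ) < δ * EN / ε} ⊆
        {ω : BondConfig (Fin n) | ω ∈ openConn o o ∧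
          ((A.filter fun a => ω ∈ openConn o a).card : ℝ) < (A.card : ℝ) / 2} := by
      intro ω hω
      exact ⟨SimpleGraph.Reachable.refl _, hω.2.trans_le ht⟩
    calc (prodBernoulli w).real {ω : BondConfig (Fin n) |
            1 ≤ (A.filter fun a => ω ∈ openConn o a).card ∧
            ((A.filter fun a => ω ∈ openConn o a).card : ℝ) < δ * EN / ε}
        ≤ (prodBernoulli w).real {ω : BondConfig (Fin n) | ω ∈ openConn o o ∧
            ((A.filter fun a => ω ∈ openConn o a).card : ℝ) < (A.card : ℝ) / 2} :=
          measureReal_mono hsub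
      _ ≤ 2 * δ := hHub o ho
      _ < ε := by nlinarith [hsum, hsq0, hp1, hLδ, hL0, hδ0]
  -- `o ∉ A`: fix a hub a₀ ∈ A and split
  obtain ⟨a₀, ha₀⟩ := hAne
  have hδ₀ : ∀ a ∈ A, (prodBernoulli w).real (openConn a a₀)ᶜ ≤ δ := fun a ha => hpair a ha a₀ ha₀
  -- the residual's hypotheses hold at level δᵣ ≥ δ
  have hpairᵣ : ∀ a ∈ A, ∀ a' ∈ A, (prodBernoulli w).real (openConn a a')ᶜ ≤ δᵣ :=
    fun a ha a' ha' => (hpair a ha a' ha').trans hδr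
  have hδ₁ᵣ : (prodBernoulli w).real (⋃ a ∈ A, openConn o a)ᶜ ≤ δᵣ := hδ₁.trans hδr
  -- the five pieces of the bad event
  set E₁ : Set (BondConfig (Fin n)) := {ω | ω ∈ openConn o a₀ ∧
      ((A.filter fun a => ω ∈ openConn o a).card : ℝ) < (A.card : ℝ) / 2} with hE₁
  set E₂ : Set (BondConfig (Fin n)) := {ω | ω ∉ openConn o a₀ ∧
      1 ≤ ((A.erase a₀).filter fun a => ω ∈ openConn o a).card ∧
      ((A.erase a₀).filter fun a => ω ∈ openConn o a).card < s₁} with hE₂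
  set E₃ : Set (BondConfig (Fin n)) := {ω | ω ∉ openConn o a₀ ∧
      1 ≤ ((A.erase a₀).filter fun a => ω ∈ openConn o a).card ∧
      (A.filter fun a => ω ∈ openConnIn ((↑A : Set (Fin n))ᶜ ∪ {o, a}) o a).card ≤ 1} with hE₃
  set E₄ : Set (BondConfig (Fin n)) := {ω | ω ∉ openConn o a₀ ∧
      2 ≤ (A.filter fun a => ω ∈ openConnIn ((↑A : Set (Fin n))ᶜ ∪ {o, a}) o a).card ∧
      (A.filter fun a => ω ∈ openConnIn ((↑A : Set (Fin n))ᶜ ∪ {o, a}) o a).card ≤ d₀} with hE₄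
  set E₅ : Set (BondConfig (Fin n)) := {ω | ω ∉ openConn o a₀ ∧
      s₀ ≤ ((A.erase a₀).filter fun a => ω ∈ openConn o a).card ∧
      2 * ((A.erase a₀).filter fun a => ω ∈ openConn o a).card ≤ A.card ∧
      d₀ < (A.filter fun a => ω ∈ openConnIn ((↑A : Set (Fin n))ᶜ ∪ {o, a}) o a).card} with hE₅
  -- their bounds
  have hB₁ : (prodBernoulli w).real E₁ ≤ 2 * δ := hHub a₀ ha₀
  have hB₂ : (prodBernoulli w).real E₂ ≤ 16 * δ * L := logScaleLowerTail n w A o a₀ δ s₁ ha₀ hδ₀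
  have hB₃ : (prodBernoulli w).real E₃ ≤ δ + 2 * Real.sqrt δ := hOne n w A o a₀ δ δ ha₀ ho hδ₀ hδ₁
  have hB₄ : (prodBernoulli w).real E₄ ≤ C₁ * (2 * δ) ^ κ₁ := by
    have h := hFew n w A o a₀ δ δ ha₀ ho hδ₀ hδ₁
    rwa [show δ + δ = 2 * δ by ring] at h
  have hB₅ : (prodBernoulli w).real E₅ ≤ ε / 2 := hMany n w A o a₀ ha₀ ho hpairᵣ hδ₁ᵣ
  -- the bad event is covered by the five pieces
  have hsub : {ω : BondConfig (Fin n) | 1 ≤ (A.filter fun a => ω ∈ openConn o a).card ∧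
      ((A.filter fun a => ω ∈ openConn o a).card : ℝ) < δ * EN / ε} ⊆
      E₁ ∪ (E₂ ∪ (E₃ ∪ (E₄ ∪ E₅))) := by
    intro ω hω
    obtain ⟨h1, h2⟩ := hω
    by_cases hoa : ω ∈ openConn o a₀
    · exact Or.inl ⟨hoa, h2.trans_le ht⟩
    · have hfilt : (A.filter fun a => ω ∈ openConn o a) =
          ((A.erase a₀).filter fun a => ω ∈ openConn o a) := by
        rw [Finset.filter_erase, Finset.erase_eq_self.mpr (by simp [hoa])]
      rw [hfilt] at h1 h2
      by_cases hsmall : ((A.erase a₀).filter fun a => ω ∈ openConn o a).card < s₁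
      · exact Or.inr (Or.inl ⟨hoa, h1, hsmall⟩)
      · have hlarge : s₀ ≤ ((A.erase a₀).filter fun a => ω ∈ openConn o a).card :=
          hs₀s₁.trans (not_lt.mp hsmall)
        have h3 : ((((A.erase a₀).filter fun a => ω ∈ openConn o a).card : ℕ) : ℝ) < A.card / 2 :=
          h2.trans_le ht
        have h4 : ((2 * ((A.erase a₀).filter fun a => ω ∈ openConn o a).card : ℕ) : ℝ) ≤ A.card := by
          push_cast; linarith
        have hhalf : 2 * ((A.erase a₀).filter fun a => ω ∈ openConn o a).card ≤ A.card := by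
          exact_mod_cast h4
        set D := (A.filter fun a => ω ∈ openConnIn ((↑A : Set (Fin n))ᶜ ∪ {o, a}) o a).card
          with hD
        by_cases hD1 : D ≤ 1
        · exact Or.inr (Or.inr (Or.inl ⟨hoa, h1, hD1⟩))
        · by_cases hDd : D ≤ d₀
          · exact Or.inr (Or.inr (Or.inr (Or.inl ⟨hoa, by omega, hDd⟩)))
          · exact Or.inr (Or.inr (Or.inr (Or.inr ⟨hoa, hlarge, hhalf, by omega⟩)))
  -- add up
  have hfin : (prodBernoulli w).real (E₁ ∪ (E₂ ∪ (E₃ ∪ (E₄ ∪ E₅)))) < ε := by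
    calc (prodBernoulli w).real (E₁ ∪ (E₂ ∪ (E₃ ∪ (E₄ ∪ E₅))))
        ≤ (prodBernoulli w).real E₁ + ((prodBernoulli w).real E₂ + ((prodBernoulli w).real E₃ +
            ((prodBernoulli w).real E₄ + (prodBernoulli w).real E₅))) := by
          refine (measureReal_union_le _ _).trans (add_le_add le_rfl ?_)
          refine (measureReal_union_le _ _).trans (add_le_add le_rfl ?_)
          refine (measureReal_union_le _ _).trans (add_le_add le_rfl ?_)
          exact measureReal_union_le _ _
      _ ≤ 2 * δ + (16 * δ * L + ((δ + 2 * Real.sqrt δ) +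
            (C₁ * (2 * δ) ^ κ₁ + ε / 2))) :=
          add_le_add hB₁ (add_le_add hB₂ (add_le_add hB₃ (add_le_add hB₄ hB₅)))
      _ = ((3 + 16 * L) * δ + 2 * Real.sqrt δ + C₁ * (2 * δ) ^ κ₁) + ε / 2 := by ring
      _ < ε / 2 + ε / 2 := by linarith
      _ = ε := by ring
  exact (measureReal_mono hsub).trans_lt hfin

end Summit.CriticalPhenomena.PercolationContinuityZ3.Cruxes.NoHeavyLowerTail.BhkSuperadditivityThinning

end
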